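import Mathlib
import HarnessLib
import Literature.MathematicalPhysics.QuantumFieldTheory.ConstructiveQFTWave0
import Literature.MathematicalPhysics.QuantumLattice.AbelianFieldTensor
import Literature.MathematicalPhysics.QuantumLattice.AbelianMagneticFlux
import Summits.Ventures.LatticeQCDFlow.Scaling.TopologicalCollar
import Summits.Ventures.LatticeQCDFlow.Scaling.FluxSectorCollar
import Summits.Ventures.LatticeQCDFlow.Scaling.SectorConfinement
import Summits.Ventures.LatticeQCDFlow.Scaling.TunnellingLaws
import Summits.Ventures.LatticeQCDFlow.Scaling.FluxPatch
import Summits.Ventures.LatticeQCDFlow.Scaling.FluxSmallSteps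

/-!
# LatticeQCDFlow / Scaling — TUNNELLING LAWS II(c): the laws for the `U(1)` flux sector (small steps and local patches)

HONEST FRAMING: exact (Metropolis-corrected) sampling algorithms for lattice gauge theory;
figures of merit are autocorrelation/cost numbers at stated couplings and volumes; no
continuum-physics claim.

THEORY-2.md §3.3 (v3.0, theory seat GEN-17).  `Scaling/TunnellingLaws.lean` proves the abstract
TUNNELLING LAW: for a `μ`-invariant Markov kernel whose moves are a.s. "allowed", the stationary
rate of charge change per step is `≤ 2·μ(B)` for every set `B` that SEPARATES the charge along the
allowed moves.  `Scaling/FluxSmallSteps.lean` and `Scaling/FluxPatch.lean` supply the two SEPARATING SETS of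
record for the geometric `U(1)` flux charge `Q = Φ_{μν}(x₀)/2π ∈ ℤ` of a `(μ,ν)`-plane of the periodic torus
`(ℤ/L)^d` (`Scaling/FluxSectorCollar.lean`), for compact `U(1) = Circle`, every `d`, every `L ≥ 1`, with NO
hypothesis on the measure; this file assembles the LAWS (§4):

* SMALL STEPS, `Scaling/FluxSmallSteps.lean` (HMC / Langevin / ODE-flow steps, any update moving every link by `≤ ρ` in chordal
  distance, or more generally moving the four links of each plane plaquette by `≤ r` in total):
  if `Q(U) ≠ Q(U')` then some plane plaquette of `U` is within chordal distance `r` (resp. `4ρ`) of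
  `-1` (`mem_planeCollar_of_topCharge_ne`, `mem_planeCollar_of_dist_le_of_topCharge_ne`).  Proof: along
  the linkwise geodesic path every plane plaquette stays within its total link displacement of its
  initial value (`dist_plaquetteHolonomy_anglePath_le`), so it never meets `-1`, and the charge — a
  continuous integer off the defect set — is constant (`topCharge_comp_eq_of_preconnected_plane`, the
  plane-local sharpening of `Scaling/SectorConfinement.lean`).
* LOCAL PATCHES, `Scaling/FluxPatch.lean` (heat bath / Metropolis link and multi-link updates, domain-decomposed or masked
  flow proposals — ANY update after which the plane plaquettes outside a finite set `P` of `m = #P`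
  plane positions are unchanged): if `Q(U) ≠ Q(U')` then `S_P(U) ≥ 2/m` or `S_P(U') ≥ 2/m`, where
  `S_P = Σ_{p ∈ P} (1 - Re u_p)` is the `β = 1` Wilson action of the patch
  (`patchAction_ge_or_of_topCharge_ne`).  Proof: `Φ - Φ' = Σ_{p∈P}(F_p - F'_p)` is a non-zero multiple
  of `2π` and `|F_p - F'_p| ≤ |F_p| + |F'_p|`, so `Σ_P |F_p| ≥ π` for `U` or for `U'`; then
  `1 - Re u_p = ‖1 - u_p‖²/2 ≥ (2/π²)F_p²` (chord bound of `Literature…AbelianFieldTensor`) and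
  Cauchy–Schwarz `Σ_P F_p² ≥ (Σ_P |F_p|)²/m`; `Scaling/CosineBudget.lean` gives the SHARP constant `m·(1 - cos(π/m))`
  (`patchAction_ge_sharp_or_of_topCharge_ne`; tangent line of `1 - cos` at `π/m` plus the cases
  `m ≤ 2`): `= 2` for `m ≤ 2` — a single-link update in `d = 2` must pass a configuration whose two
  plane plaquettes at the link carry Wilson weight `≤ e^{-2β}` relative to their maximum — and
  `∼ π²/(2m)` for large patches.
* §4 THE LAWS (this file): with `Scaling/TunnellingLaws.lean`, for every probability (indeed s-finite) measure `m`
  on `U(1)^E` and every `m`-invariant Markov kernel `κ` — exactness is the only dynamical input —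
  `(m ⊗ κ){Q ≠ Q'} ≤ 2·m(planeCollar 4ρ) ≤ 2·Σ_p m{‖u_p + 1‖ ≤ 4ρ} = 2L²·(one-plaquette cut tail)`
  for `ρ`-small steps (`compProd_topCharge_ne_le_of_dist_le`, `measure_planeCollar_le`,
  `compProd_topCharge_ne_le_of_plaquetteTail`), and `(m ⊗ κ){Q ≠ Q'} ≤ 2·m{S_P ≥ 2/#P}`
  (sharp: `≤ 2·m{S_P ≥ #P(1 - cos(π/#P))}`) for `P`-local updates (`compProd_topCharge_ne_le_of_patch`,
  `compProd_topCharge_ne_le_of_patch_sharp`, `compProd_topCharge_ne_le_of_links`); `n`-step versions for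
  processes with stationary marginals (`measure_topCharge_ne_le_nsteps_of_dist_le`,
  `measure_topCharge_ne_le_nsteps_of_patch`; the integrated-autocorrelation reading is
  `Tunnelling.sectorAutocov_ge`).  The Gibbs tails `m_β{‖u_p+1‖ ≤ s}` and `m_β{S_P ≥ 2/m}` are NOT
  estimated here (they enter THEORY-2.md §3.3 as the typed hypotheses `η`, `M` of the last theorems;
  for the 2-d Wilson `U(1)` plaquette density `∝ e^{β cos θ}` they are `≍ e^{-2β}·poly` — a printed /
  heuristic input, not a theorem of the tree).

Evidence the laws are read against (THEORY-2.md §3.3, pages cited there): 2-d `U(1)`, `L = 16`,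
`β = 7`: `τ_int(Q) ≈ 15000` (HMC), `≈ 4000` (heat bath), `≈ 10` (global flow proposals)
[cite: KanwarEtAl2020, p.5]; `τ_top ∼ exp(c ξ^θ)` for local algorithms
[cite: DeldebbioMancaVicari2004, pp.2,4,5]; in `SU(3)` the probability of non-admissible fields is
`O(a^6)` and "it is unlikely that [an HMC] trajectory leads from one sector to another"
[cite: Luscher2010WilsonFlow, pp.6–7] — the heuristic these theorems make quantitative for `U(1)`.
GLOBAL flow proposals (all links moved by `O(1)`) are the one update class the laws do not price:
that is the recorded evasion, and the reason flow proposals are pursued.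
-/

noncomputable section

namespace Summit.Ventures.LatticeQCDFlow.Theory2.Lattice.Flux

open MeasureTheory ProbabilityTheory Metric Set Filter Topology Real
open scoped ENNReal
open Literature.MathematicalPhysics.QuantumFieldTheory Literature.MathematicalPhysics.QuantumLattice

variable {d L : ℕ}

variable [NeZero L]

/-! ## §4. The tunnelling laws for the flux charge -/

section Laws

variable (x₀ : Site d L) (μ ν : Fin d)

/-- Union bound: the plane collar costs at most `L²` single-plaquette cut tails. [folklore] -/
theorem measure_planeCollar_le (m : Measure (GaugeConfig d L Circle)) (s : ℝ) :
    m (planeCollar x₀ μ ν s) ≤ ∑ p : ZMod L × ZMod L,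
      m {U | ‖((plaquetteHolonomy U (planeSite x₀ μ ν p) μ ν : Circle) : ℂ) + 1‖ ≤ s} := by
  have e : planeCollar x₀ μ ν s = ⋃ p : ZMod L × ZMod L,
      {U | ‖((plaquetteHolonomy U (planeSite x₀ μ ν p) μ ν : Circle) : ℂ) + 1‖ ≤ s} := by
    ext U; simp [planeCollar]
  rw [e]
  exact measure_iUnion_fintype_le m _

/-- **SMALL-STEP TUNNELLING LAW (kernel form).**  For ANY s-finite measure `m` on `U(1)^E` and any
`m`-invariant Markov kernel whose steps are `m ⊗ κ`-a.s. `ρ`-small in the sup chordal metric, the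
stationary probability per step of a change of the plane charge is at most twice the mass of the
plane collar of width `4ρ`. [folklore] -/
theorem compProd_topCharge_ne_le_of_dist_le (m : Measure (GaugeConfig d L Circle)) [SFinite m]
    (κ : Kernel (GaugeConfig d L Circle) (GaugeConfig d L Circle)) [IsMarkovKernel κ]
    (hinv : κ.Invariant m) {ρ : ℝ} (hstep : ∀ᵐ q ∂(m ⊗ₘ κ), dist q.1 q.2 ≤ ρ) :
    (m ⊗ₘ κ) {q | topCharge x₀ μ ν q.1 ≠ topCharge x₀ μ ν q.2} ≤
      2 * m (planeCollar x₀ μ ν (4 * ρ)) :=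
  Tunnelling.compProd_chargeChange_le_of_invariant (R := fun U U' : GaugeConfig d L Circle => dist U U' ≤ ρ)
    (Q := topCharge x₀ μ ν) (B := planeCollar x₀ μ ν (4 * ρ))
    (fun _ _ hUU' hQ => Or.inl (mem_planeCollar_of_dist_le_of_topCharge_ne x₀ μ ν hUU' hQ)) m κ hinv hstep

/-- The same for per-plaquette-small steps (total displacement of the four links of every plane
plaquette `≤ r`, e.g. `r = 4ρ` for `ρ`-small links; the natural hypothesis for updates that move only
some links). [folklore] -/
theorem compProd_topCharge_ne_le_of_plaqDisp_le (m : Measure (GaugeConfig d L Circle)) [SFinite m]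
    (κ : Kernel (GaugeConfig d L Circle) (GaugeConfig d L Circle)) [IsMarkovKernel κ]
    (hinv : κ.Invariant m) {r : ℝ}
    (hstep : ∀ᵐ q ∂(m ⊗ₘ κ), ∀ p : ZMod L × ZMod L, plaqDisp q.1 q.2 (planeSite x₀ μ ν p) μ ν ≤ r) :
    (m ⊗ₘ κ) {q | topCharge x₀ μ ν q.1 ≠ topCharge x₀ μ ν q.2} ≤ 2 * m (planeCollar x₀ μ ν r) :=
  Tunnelling.compProd_chargeChange_le_of_invariant
    (R := fun U U' : GaugeConfig d L Circle => ∀ p : ZMod L × ZMod L, plaqDisp U U' (planeSite x₀ μ ν p) μ ν ≤ r)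
    (Q := topCharge x₀ μ ν) (B := planeCollar x₀ μ ν r)
    (fun _ _ hUU' hQ => Or.inl (mem_planeCollar_of_topCharge_ne x₀ μ ν hUU' hQ)) m κ hinv hstep

/-- **SMALL-STEP LAW WITH A ONE-PLAQUETTE TAIL.**  If every plane plaquette has cut tail
`m{‖u_p + 1‖ ≤ 4ρ} ≤ η`, the tunnelling probability per `ρ`-small exact step is `≤ 2·L²·η` — linear in
the plane AREA, exponentially small in `β` through `η` (THEORY-2.md §3.3: `η ≍ e^{-2β}` for the 2-d
Wilson weight; a hypothesis here). [folklore] -/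
theorem compProd_topCharge_ne_le_of_plaquetteTail (m : Measure (GaugeConfig d L Circle)) [SFinite m]
    (κ : Kernel (GaugeConfig d L Circle) (GaugeConfig d L Circle)) [IsMarkovKernel κ]
    (hinv : κ.Invariant m) {ρ : ℝ} (hstep : ∀ᵐ q ∂(m ⊗ₘ κ), dist q.1 q.2 ≤ ρ) {η : ℝ≥0∞}
    (hη : ∀ p : ZMod L × ZMod L,
      m {U | ‖((plaquetteHolonomy U (planeSite x₀ μ ν p) μ ν : Circle) : ℂ) + 1‖ ≤ 4 * ρ} ≤ η) :
    (m ⊗ₘ κ) {q | topCharge x₀ μ ν q.1 ≠ topCharge x₀ μ ν q.2} ≤ 2 * ((L : ℝ≥0∞) ^ 2 * η) := by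
  have hcol : m (planeCollar x₀ μ ν (4 * ρ)) ≤ (L : ℝ≥0∞) ^ 2 * η := by
    refine (measure_planeCollar_le x₀ μ ν m (4 * ρ)).trans ?_
    calc ∑ p : ZMod L × ZMod L,
          m {U | ‖((plaquetteHolonomy U (planeSite x₀ μ ν p) μ ν : Circle) : ℂ) + 1‖ ≤ 4 * ρ}
        ≤ ∑ _p : ZMod L × ZMod L, η := Finset.sum_le_sum fun p _ => hη p
      _ = (L : ℝ≥0∞) ^ 2 * η := by
          rw [Finset.sum_const, Finset.card_univ, Fintype.card_prod, ZMod.card, nsmul_eq_mul]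
          push_cast
          ring
  calc (m ⊗ₘ κ) {q | topCharge x₀ μ ν q.1 ≠ topCharge x₀ μ ν q.2}
      ≤ 2 * m (planeCollar x₀ μ ν (4 * ρ)) := compProd_topCharge_ne_le_of_dist_le x₀ μ ν m κ hinv hstep
    _ ≤ 2 * ((L : ℝ≥0∞) ^ 2 * η) := by gcongr

/-- **PATCH-LOCAL TUNNELLING LAW (kernel form).**  For ANY s-finite measure `m` and any `m`-invariant
Markov kernel whose steps `m ⊗ κ`-a.s. leave the plane plaquettes outside the patch `P` unchanged, the
stationary probability per step of a change of the plane charge is at most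
`2·m{S_P ≥ 2/#P}`. [folklore] -/
theorem compProd_topCharge_ne_le_of_patch (P : Finset (ZMod L × ZMod L))
    (m : Measure (GaugeConfig d L Circle)) [SFinite m]
    (κ : Kernel (GaugeConfig d L Circle) (GaugeConfig d L Circle)) [IsMarkovKernel κ]
    (hinv : κ.Invariant m)
    (hloc : ∀ᵐ q ∂(m ⊗ₘ κ), ∀ p ∉ P, plaquetteHolonomy q.1 (planeSite x₀ μ ν p) μ ν =
      plaquetteHolonomy q.2 (planeSite x₀ μ ν p) μ ν) :
    (m ⊗ₘ κ) {q | topCharge x₀ μ ν q.1 ≠ topCharge x₀ μ ν q.2} ≤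
      2 * m {U | 2 / (P.card : ℝ) ≤ patchAction x₀ μ ν P U} :=
  Tunnelling.compProd_chargeChange_le_of_invariant
    (R := fun U U' : GaugeConfig d L Circle => ∀ p ∉ P, plaquetteHolonomy U (planeSite x₀ μ ν p) μ ν =
      plaquetteHolonomy U' (planeSite x₀ μ ν p) μ ν)
    (Q := topCharge x₀ μ ν) (B := {U | 2 / (P.card : ℝ) ≤ patchAction x₀ μ ν P U})
    (fun _ _ hUU' hQ => patchAction_ge_or_of_topCharge_ne x₀ μ ν hUU' hQ) m κ hinv hloc

/-- **PATCH-LOCAL TUNNELLING LAW, sharp threshold** `#P·(1 - cos(π/#P))` (non-empty patch). [folklore] -/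
theorem compProd_topCharge_ne_le_of_patch_sharp {P : Finset (ZMod L × ZMod L)} (hP : P.Nonempty)
    (m : Measure (GaugeConfig d L Circle)) [SFinite m]
    (κ : Kernel (GaugeConfig d L Circle) (GaugeConfig d L Circle)) [IsMarkovKernel κ]
    (hinv : κ.Invariant m)
    (hloc : ∀ᵐ q ∂(m ⊗ₘ κ), ∀ p ∉ P, plaquetteHolonomy q.1 (planeSite x₀ μ ν p) μ ν =
      plaquetteHolonomy q.2 (planeSite x₀ μ ν p) μ ν) :
    (m ⊗ₘ κ) {q | topCharge x₀ μ ν q.1 ≠ topCharge x₀ μ ν q.2} ≤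
      2 * m {U | (P.card : ℝ) * (1 - Real.cos (π / P.card)) ≤ patchAction x₀ μ ν P U} :=
  Tunnelling.compProd_chargeChange_le_of_invariant
    (R := fun U U' : GaugeConfig d L Circle => ∀ p ∉ P, plaquetteHolonomy U (planeSite x₀ μ ν p) μ ν =
      plaquetteHolonomy U' (planeSite x₀ μ ν p) μ ν)
    (Q := topCharge x₀ μ ν)
    (B := {U | (P.card : ℝ) * (1 - Real.cos (π / P.card)) ≤ patchAction x₀ μ ν P U})
    (fun _ _ hUU' hQ => patchAction_ge_sharp_or_of_topCharge_ne x₀ μ ν hP hUU' hQ) m κ hinv hloc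

/-- **LINK-LOCAL TUNNELLING LAW.**  The same for kernels whose steps change only the links of a fixed
finite set `Λ` (single-link heat bath / Metropolis: `#Λ = 1`, `#P = 2` in `d = 2`; a masked or
domain-decomposed flow proposal acting on the links of a block): `P` is any set of plane positions
containing those whose plaquette touches `Λ`. [folklore] -/
theorem compProd_topCharge_ne_le_of_links (Λ : Finset (Edge d L)) (P : Finset (ZMod L × ZMod L))
    (hP : ∀ p, (∃ e ∈ plaqLinks (planeSite x₀ μ ν p) μ ν, e ∈ Λ) → p ∈ P)
    (m : Measure (GaugeConfig d L Circle)) [SFinite m]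
    (κ : Kernel (GaugeConfig d L Circle) (GaugeConfig d L Circle)) [IsMarkovKernel κ]
    (hinv : κ.Invariant m) (hloc : ∀ᵐ q ∂(m ⊗ₘ κ), ∀ e ∉ Λ, q.1 e = q.2 e) :
    (m ⊗ₘ κ) {q | topCharge x₀ μ ν q.1 ≠ topCharge x₀ μ ν q.2} ≤
      2 * m {U | 2 / (P.card : ℝ) ≤ patchAction x₀ μ ν P U} := by
  refine compProd_topCharge_ne_le_of_patch x₀ μ ν P m κ hinv ?_
  filter_upwards [hloc] with q hq
  exact plaquette_eq_off_patch_of_links hP hq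

/-- **LINK-LOCAL TUNNELLING LAW, sharp threshold**: an update of the links in `Λ` (the rest a.s. fixed)
tunnels with stationary probability `≤ 2·m{S_P ≥ #P(1 - cos(π/#P))}` for any non-empty set `P` of plane
positions containing those whose plaquette touches `Λ`. [folklore] -/
theorem compProd_topCharge_ne_le_of_links_sharp (Λ : Finset (Edge d L)) {P : Finset (ZMod L × ZMod L)}
    (hPne : P.Nonempty) (hP : ∀ p, (∃ e ∈ plaqLinks (planeSite x₀ μ ν p) μ ν, e ∈ Λ) → p ∈ P)
    (m : Measure (GaugeConfig d L Circle)) [SFinite m]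
    (κ : Kernel (GaugeConfig d L Circle) (GaugeConfig d L Circle)) [IsMarkovKernel κ]
    (hinv : κ.Invariant m) (hloc : ∀ᵐ q ∂(m ⊗ₘ κ), ∀ e ∉ Λ, q.1 e = q.2 e) :
    (m ⊗ₘ κ) {q | topCharge x₀ μ ν q.1 ≠ topCharge x₀ μ ν q.2} ≤
      2 * m {U | (P.card : ℝ) * (1 - Real.cos (π / P.card)) ≤ patchAction x₀ μ ν P U} := by
  refine compProd_topCharge_ne_le_of_patch_sharp x₀ μ ν hPne m κ hinv ?_
  filter_upwards [hloc] with q hq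
  exact plaquette_eq_off_patch_of_links hP hq

/-- **PATCH LAW WITH A PATCH-ACTION TAIL `M`.** [folklore] -/
theorem compProd_topCharge_ne_le_of_patchTail (P : Finset (ZMod L × ZMod L))
    (m : Measure (GaugeConfig d L Circle)) [SFinite m]
    (κ : Kernel (GaugeConfig d L Circle) (GaugeConfig d L Circle)) [IsMarkovKernel κ]
    (hinv : κ.Invariant m)
    (hloc : ∀ᵐ q ∂(m ⊗ₘ κ), ∀ p ∉ P, plaquetteHolonomy q.1 (planeSite x₀ μ ν p) μ ν =
      plaquetteHolonomy q.2 (planeSite x₀ μ ν p) μ ν)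
    {M : ℝ≥0∞} (hM : m {U | 2 / (P.card : ℝ) ≤ patchAction x₀ μ ν P U} ≤ M) :
    (m ⊗ₘ κ) {q | topCharge x₀ μ ν q.1 ≠ topCharge x₀ μ ν q.2} ≤ 2 * M :=
  (compProd_topCharge_ne_le_of_patch x₀ μ ν P m κ hinv hloc).trans (by gcongr)

variable {Ω : Type*} [MeasurableSpace Ω]

/-- **`n`-STEP SMALL-STEP LAW.**  A process `Z` with all marginals equal to `m` (e.g. a stationary
exact chain) and a.s. `ρ`-small steps changes the plane charge within `n` steps with probability
`≤ n · 2·m(planeCollar 4ρ)`; with `Tunnelling.sectorAutocov_ge` this is a floor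
`a(1-a) - n·2m(planeCollar 4ρ)` under the lag-`n` autocovariance of every sector indicator of
stationary mass `a`. [folklore] -/
theorem measure_topCharge_ne_le_nsteps_of_dist_le (P : Measure Ω) (Z : ℕ → Ω → GaugeConfig d L Circle)
    (hZ : ∀ k, Measurable (Z k)) (m : Measure (GaugeConfig d L Circle)) (hmarg : ∀ k, P.map (Z k) = m)
    {ρ : ℝ} (hstep : ∀ k, ∀ᵐ ω ∂P, dist (Z k ω) (Z (k + 1) ω) ≤ ρ) (n : ℕ) :
    P {ω | topCharge x₀ μ ν (Z n ω) ≠ topCharge x₀ μ ν (Z 0 ω)} ≤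
      n * (2 * m (planeCollar x₀ μ ν (4 * ρ))) := by
  have hle : ∀ k, P (Z k ⁻¹' planeCollar x₀ μ ν (4 * ρ)) ≤ m (planeCollar x₀ μ ν (4 * ρ)) := by
    intro k
    rw [← hmarg k]
    exact Measure.le_map_apply (hZ k).aemeasurable _
  refine Tunnelling.measure_chargeChange_le_nsteps
    (R := fun _ (U U' : GaugeConfig d L Circle) => dist U U' ≤ ρ) (Q := topCharge x₀ μ ν)
    (B := fun _ => planeCollar x₀ μ ν (4 * ρ))
    (fun _ _ _ hUU' hQ => Or.inl (mem_planeCollar_of_dist_le_of_topCharge_ne x₀ μ ν hUU' hQ)) P Z hstep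
    (fun k => ?_) n
  rw [two_mul]
  exact add_le_add (hle k) (hle (k + 1))

/-- **`n`-STEP PATCH LAW** (patches `P_k` may vary with the step, e.g. a sweep). [folklore] -/
theorem measure_topCharge_ne_le_nsteps_of_patch (P : Measure Ω) (Z : ℕ → Ω → GaugeConfig d L Circle)
    (hZ : ∀ k, Measurable (Z k)) (m : Measure (GaugeConfig d L Circle)) (hmarg : ∀ k, P.map (Z k) = m)
    (Pk : ℕ → Finset (ZMod L × ZMod L))
    (hloc : ∀ k, ∀ᵐ ω ∂P, ∀ p ∉ Pk k, plaquetteHolonomy (Z k ω) (planeSite x₀ μ ν p) μ ν =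
      plaquetteHolonomy (Z (k + 1) ω) (planeSite x₀ μ ν p) μ ν)
    {M : ℝ≥0∞} (hM : ∀ k, m {U | 2 / ((Pk k).card : ℝ) ≤ patchAction x₀ μ ν (Pk k) U} ≤ M) (n : ℕ) :
    P {ω | topCharge x₀ μ ν (Z n ω) ≠ topCharge x₀ μ ν (Z 0 ω)} ≤ n * (2 * M) := by
  have hle : ∀ j k, P (Z j ⁻¹' {U | 2 / ((Pk k).card : ℝ) ≤ patchAction x₀ μ ν (Pk k) U}) ≤ M := by
    intro j k
    refine le_trans ?_ (hM k)
    rw [← hmarg j]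
    exact Measure.le_map_apply (hZ j).aemeasurable _
  refine Tunnelling.measure_chargeChange_le_nsteps
    (R := fun k (U U' : GaugeConfig d L Circle) => ∀ p ∉ Pk k,
      plaquetteHolonomy U (planeSite x₀ μ ν p) μ ν = plaquetteHolonomy U' (planeSite x₀ μ ν p) μ ν)
    (Q := topCharge x₀ μ ν) (B := fun k => {U | 2 / ((Pk k).card : ℝ) ≤ patchAction x₀ μ ν (Pk k) U})
    (fun k _ _ hUU' hQ => patchAction_ge_or_of_topCharge_ne x₀ μ ν hUU' hQ) P Z hloc (fun k => ?_) n
  rw [two_mul]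
  exact add_le_add (hle k k) (hle (k + 1) k)

end Laws

end Summit.Ventures.LatticeQCDFlow.Theory2.Lattice.Flux
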